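import Summits.AtomisticToContinuum.HydrodynamicLimit.Theorems.CollisionIsometryCLTAdaptedWeightCLTSustainedAnisotropy
import Summits.AtomisticToContinuum.HydrodynamicLimit.Theorems.CollisionIsometryCLTAdaptedWeightCLTTLPastDampingKernel
import Summits.AtomisticToContinuum.HydrodynamicLimit.Theorems.CollisionIsometryCLTAdaptedWeightCLTCBTailsVmax

/-!
# Line `sustained-anisotropy-superexp`, stub `stub_superExp` (lead), file 2: the canonical cell kernel and kinetic window

Crux `CollisionIsometryCLT.AdaptedWeightCLT` (stmt-AtomisticToContinuum-14868, rev-12 TIME-LOCAL form), route `CollisionIsometryCLT`,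
sub-problem `HydrodynamicLimit`; line lead `prover-line-stmt-AtomisticToContinuum-14868-a1-0`; `--supports` helper toward the registered
stub `stub_superExp`.

The registered stub begins with `∃ (ψ : ℕ → T3 → ℝ) (ℓ Δ : ℕ → ℝ), CellKernel ψ ℓ ∧ Window Δ ∧ K_N ≫ L_N² ∧ K_N ≫ m_cell ∧ …`.
This file DISCHARGES the existential constructively, once and for all, independently of `σ`, the block kernel and the flow:

* `cellRad N = (N+1)^{-1/4}/4` (cell radius `ℓ_N ≤ 1/4`), `kinWin N = (N+1)^{-1/24}` (window `Δ_N`);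
* `cellKer N` = the normalised TENT of the minimal-image distance to the origin, `max 0 (1 − d(y,0)/ℓ_N) / ∫ tent` — continuous (no
  smoothness is asked by `CellKernel`), nonnegative, mass one, supported in the ball of radius `ℓ_N`, height `≤ (16/|B₁|) ℓ_N⁻³`,
  `≥ (1/(2|B₁|)) ℓ_N⁻³` on the half ball (`|B₁|` = volume of the Euclidean unit ball, `PastDamping.ballVol`);
* `cellKernel_cellKer : CellKernel cellKer cellRad`, `window_kinWin : Window kinWin`, and the two scale relations
  `Δ_N/(ℓ_N²(N+1)^{1/3}) = 16 (N+1)^{1/8} → ∞`, `Δ_N (N+1)^{1/3}/((N+1)ℓ_N³) = 64 (N+1)^{1/24} → ∞`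
  (`tendsto_scale_viscous`, `tendsto_scale_decoupling`);
* `superExpStub_of_core`: hence `SuperExpStub` follows from its CORE — the same bound for THESE scales at the window START `t' = Δ_N`
  is the only thing left to prove (uniformity in `t'` is file 1, `…SASuperExpInvariance`).
-/

namespace Summit.AtomisticToContinuum.HydrodynamicLimit.Theorems.SustainedAnisotropy

open scoped BigOperators Topology Classical MeasureTheory ENNReal InnerProductSpace
open Filter Set MeasureTheory
open Literature.Analysis.FluidPDE
open Summit.AtomisticToContinuum.HydrodynamicLimit.Theorems.ContactSourceDuhamel
open Summit.AtomisticToContinuum.HydrodynamicLimit.Theorems.ContactSourceDuhamel.TimeLocal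
open Summit.AtomisticToContinuum.HydrodynamicLimit.Theorems.ContactSourceDuhamel.TimeLocal.PastDamping
  (ballVol ballVol_nonneg volumeReal_euclidDist_lt integrable_of_continuous_T3 euclidDist_sub_zero
    measurableSet_euclidDist_lt)
open Summit.AtomisticToContinuum.HydrodynamicLimit.Theorems.ContactBalance
open Literature.MathematicalPhysics.KineticTheory (hsDiameter localGibbsLaw)

noncomputable section

namespace SuperExp

/-! ## The scales -/

/-- The base `x_N = N + 1 ≥ 1` of all the powers. -/
def base (N : ℕ) : ℝ := ((N + 1 : ℕ) : ℝ)

/-- `x_N > 0`. -/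
theorem base_pos (N : ℕ) : 0 < base N := by unfold base; positivity

/-- `x_N ≥ 1`. -/
theorem one_le_base (N : ℕ) : 1 ≤ base N := by unfold base; exact_mod_cast Nat.succ_pos N

/-- The CELL RADIUS `ℓ_N = (N+1)^{-1/4}/4`. -/
def cellRad (N : ℕ) : ℝ := 4⁻¹ * base N ^ (-(1 / 4 : ℝ))

/-- The KINETIC WINDOW `Δ_N = (N+1)^{-1/24}`. -/
def kinWin (N : ℕ) : ℝ := base N ^ (-(1 / 24 : ℝ))

/-- `ℓ_N > 0`. -/
theorem cellRad_pos (N : ℕ) : 0 < cellRad N := by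
  unfold cellRad; exact mul_pos (by norm_num) (Real.rpow_pos_of_pos (base_pos N) _)

/-- `ℓ_N ≤ 1/4` (so every cell ball is a honest minimal-image ball, radius `< 1/2`). -/
theorem cellRad_le (N : ℕ) : cellRad N ≤ 4⁻¹ := by
  unfold cellRad
  have h : base N ^ (-(1 / 4 : ℝ)) ≤ 1 :=
    Real.rpow_le_one_of_one_le_of_nonpos (one_le_base N) (by norm_num)
  calc 4⁻¹ * base N ^ (-(1 / 4 : ℝ)) ≤ 4⁻¹ * 1 := mul_le_mul_of_nonneg_left h (by norm_num)
    _ = 4⁻¹ := mul_one _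

/-- `ℓ_N < 1/2`. -/
theorem cellRad_lt_half (N : ℕ) : cellRad N < 1 / 2 := (cellRad_le N).trans_lt (by norm_num)

/-- `Δ_N > 0`. -/
theorem kinWin_pos (N : ℕ) : 0 < kinWin N := Real.rpow_pos_of_pos (base_pos N) _

/-! ## The tent kernel -/

/-- The un-normalised TENT of radius `ℓ_N` about the origin: `max 0 (1 − d(y, 0)/ℓ_N)`. -/
def saTent (N : ℕ) (y : T3) : ℝ := max 0 (1 - Torus.euclidDist y 0 / cellRad N)

/-- `0 ≤ saTent`. -/
theorem saTent_nonneg (N : ℕ) (y : T3) : 0 ≤ saTent N y := le_max_left _ _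

/-- `saTent ≤ 1`. -/
theorem saTent_le_one (N : ℕ) (y : T3) : saTent N y ≤ 1 := by
  unfold saTent
  refine max_le zero_le_one ?_
  have h : 0 ≤ Torus.euclidDist y 0 / cellRad N :=
    div_nonneg (by rw [Torus.euclidDist_eq]; exact norm_nonneg _) (cellRad_pos N).le
  linarith

/-- The minimal-image distance to the origin is continuous. -/
theorem continuous_euclidDist_zero : Continuous fun y : T3 => Torus.euclidDist y 0 := by
  simp_rw [Torus.euclidDist_eq, sub_zero]
  exact Torus.continuous_norm_reprSym

/-- The tent is continuous. -/
theorem continuous_saTent (N : ℕ) : Continuous (saTent N) := by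
  have h1 : Continuous fun y : T3 => 1 - Torus.euclidDist y 0 / cellRad N :=
    continuous_const.sub (continuous_euclidDist_zero.div_const (cellRad N))
  exact continuous_const.max h1

/-- The tent vanishes outside the ball of radius `ℓ_N`. -/
theorem saTent_eq_zero_of_le (N : ℕ) {y : T3} (hy : cellRad N ≤ Torus.euclidDist y 0) : saTent N y = 0 := by
  unfold saTent
  refine max_eq_left ?_
  have h : 1 ≤ Torus.euclidDist y 0 / cellRad N := by rw [le_div_iff₀ (cellRad_pos N), one_mul]; exact hy
  linarith

/-- On the half ball the tent is at least `1/2`. -/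
theorem half_le_saTent (N : ℕ) {y : T3} (hy : Torus.euclidDist y 0 ≤ cellRad N / 2) : 1 / 2 ≤ saTent N y := by
  unfold saTent
  refine le_trans ?_ (le_max_right _ _)
  have h : Torus.euclidDist y 0 / cellRad N ≤ 1 / 2 := by
    rw [div_le_iff₀ (cellRad_pos N)]; linarith
  linarith

/-- The tent is dominated by the indicator of the ball of radius `ℓ_N`. -/
theorem saTent_le_indicator (N : ℕ) (y : T3) :
    saTent N y ≤ Set.indicator {x : T3 | Torus.euclidDist x 0 < cellRad N} (fun _ => (1 : ℝ)) y := by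
  by_cases h : Torus.euclidDist y 0 < cellRad N
  · rw [Set.indicator_of_mem (show y ∈ {x : T3 | Torus.euclidDist x 0 < cellRad N} from h)]
    exact saTent_le_one N y
  · rw [Set.indicator_of_notMem (show y ∉ {x : T3 | Torus.euclidDist x 0 < cellRad N} from h),
      saTent_eq_zero_of_le N (not_lt.1 h)]

/-- Half the indicator of the half ball is dominated by the tent. -/
theorem indicator_le_saTent (N : ℕ) (y : T3) :
    Set.indicator {x : T3 | Torus.euclidDist x 0 < cellRad N / 2} (fun _ => (1 / 2 : ℝ)) y ≤ saTent N y := by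
  by_cases h : Torus.euclidDist y 0 < cellRad N / 2
  · rw [Set.indicator_of_mem (show y ∈ {x : T3 | Torus.euclidDist x 0 < cellRad N / 2} from h)]
    exact half_le_saTent N h.le
  · rw [Set.indicator_of_notMem (show y ∉ {x : T3 | Torus.euclidDist x 0 < cellRad N / 2} from h)]
    exact saTent_nonneg N y

/-- The MASS of the tent. -/
def saTentMass (N : ℕ) : ℝ := ∫ y, saTent N y

/-- Upper bound: `∫ saTent ≤ |B_{ℓ_N}| = ℓ_N³ |B₁|`. -/
theorem saTentMass_le (N : ℕ) : saTentMass N ≤ cellRad N ^ 3 * ballVol := by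
  unfold saTentMass
  have hS : MeasurableSet {x : T3 | Torus.euclidDist x 0 < cellRad N} := measurableSet_euclidDist_lt 0 _
  haveI := Reduction.isFiniteMeasure_volume_T3
  calc ∫ y, saTent N y ≤ ∫ y, Set.indicator {x : T3 | Torus.euclidDist x 0 < cellRad N} (fun _ => (1 : ℝ)) y :=
        integral_mono (integrable_of_continuous_T3 (continuous_saTent N))
          ((integrable_const (1 : ℝ)).indicator hS) (saTent_le_indicator N)
    _ = (volume {x : T3 | Torus.euclidDist x 0 < cellRad N}).toReal := by
        rw [integral_indicator hS, setIntegral_const, smul_eq_mul, mul_one]; rfl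
    _ = cellRad N ^ 3 * ballVol := volumeReal_euclidDist_lt 0 (cellRad_pos N) (cellRad_lt_half N)

/-- Lower bound: `∫ saTent ≥ ½ |B_{ℓ_N/2}| = ℓ_N³ |B₁| / 16`. -/
theorem le_saTentMass (N : ℕ) : cellRad N ^ 3 * ballVol / 16 ≤ saTentMass N := by
  unfold saTentMass
  have hS : MeasurableSet {x : T3 | Torus.euclidDist x 0 < cellRad N / 2} := measurableSet_euclidDist_lt 0 _
  haveI := Reduction.isFiniteMeasure_volume_T3
  have hr : 0 < cellRad N / 2 := by linarith [cellRad_pos N]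
  have hr' : cellRad N / 2 < 1 / 2 := by linarith [cellRad_lt_half N]
  calc cellRad N ^ 3 * ballVol / 16 = 1 / 2 * ((cellRad N / 2) ^ 3 * ballVol) := by ring
    _ = ∫ y, Set.indicator {x : T3 | Torus.euclidDist x 0 < cellRad N / 2} (fun _ => (1 / 2 : ℝ)) y := by
        rw [integral_indicator hS, setIntegral_const, smul_eq_mul, ← volumeReal_euclidDist_lt 0 hr hr', mul_comm]
        rfl
    _ ≤ ∫ y, saTent N y :=
        integral_mono ((integrable_const (1 / 2 : ℝ)).indicator hS)
          (integrable_of_continuous_T3 (continuous_saTent N)) (indicator_le_saTent N)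

/-- `|B₁| > 0`. -/
theorem ballVol_pos : 0 < ballVol := by
  unfold ballVol
  exact ENNReal.toReal_pos (Metric.measure_ball_pos volume (0 : V3) one_pos).ne' measure_ball_lt_top.ne

/-- The tent has positive mass. -/
theorem saTentMass_pos (N : ℕ) : 0 < saTentMass N :=
  lt_of_lt_of_le (by have := cellRad_pos N; have := ballVol_pos; positivity) (le_saTentMass N)

/-- The CELL KERNEL `ψ_N = saTent / ∫ saTent`. -/
def cellKer (N : ℕ) (y : T3) : ℝ := (saTentMass N)⁻¹ * saTent N y

/-- `ψ_N` is continuous. -/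
theorem continuous_cellKer (N : ℕ) : Continuous (cellKer N) :=
  continuous_const.mul (continuous_saTent N)

/-- `0 ≤ ψ_N`. -/
theorem cellKer_nonneg (N : ℕ) (y : T3) : 0 ≤ cellKer N y :=
  mul_nonneg (inv_nonneg.2 (saTentMass_pos N).le) (saTent_nonneg N y)

/-- `∫ ψ_N = 1`. -/
theorem integral_cellKer (N : ℕ) : ∫ y, cellKer N y = 1 := by
  unfold cellKer
  rw [integral_const_mul]
  exact inv_mul_cancel₀ (saTentMass_pos N).ne'

/-- `ψ_N` vanishes outside the ball of radius `ℓ_N`. -/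
theorem cellKer_eq_zero_of_le (N : ℕ) {y : T3} (hy : cellRad N ≤ Torus.euclidDist y 0) : cellKer N y = 0 := by
  unfold cellKer; rw [saTent_eq_zero_of_le N hy, mul_zero]

/-- Height: `ψ_N ≤ (16/|B₁|) ℓ_N⁻³`. -/
theorem cellKer_le (N : ℕ) (y : T3) : cellKer N y ≤ 16 / ballVol * (cellRad N)⁻¹ ^ 3 := by
  have hm := saTentMass_pos N
  have hℓ := cellRad_pos N
  have hB := ballVol_pos
  calc cellKer N y ≤ (saTentMass N)⁻¹ * 1 :=
        mul_le_mul_of_nonneg_left (saTent_le_one N y) (inv_nonneg.2 hm.le)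
    _ ≤ (cellRad N ^ 3 * ballVol / 16)⁻¹ := by
        rw [mul_one]; exact inv_anti₀ (by positivity) (le_saTentMass N)
    _ = 16 / ballVol * (cellRad N)⁻¹ ^ 3 := by
        rw [inv_pow]; field_simp

/-- Core: `ψ_N ≥ (1/(2|B₁|)) ℓ_N⁻³` on the half ball. -/
theorem le_cellKer (N : ℕ) {y : T3} (hy : Torus.euclidDist y 0 ≤ cellRad N / 2) :
    1 / (2 * ballVol) * (cellRad N)⁻¹ ^ 3 ≤ cellKer N y := by
  have hm := saTentMass_pos N
  have hℓ := cellRad_pos N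
  have hB := ballVol_pos
  calc 1 / (2 * ballVol) * (cellRad N)⁻¹ ^ 3 = (cellRad N ^ 3 * ballVol)⁻¹ * (1 / 2) := by
        rw [inv_pow]; field_simp
    _ ≤ (saTentMass N)⁻¹ * (1 / 2) :=
        mul_le_mul_of_nonneg_right (inv_anti₀ hm (saTentMass_le N)) (by norm_num)
    _ ≤ (saTentMass N)⁻¹ * saTent N y := mul_le_mul_of_nonneg_left (half_le_saTent N hy) (inv_nonneg.2 hm.le)
    _ = cellKer N y := rfl

/-! ## Power bookkeeping and the limits -/

/-- `x_N^{a} · x_N^{b} = x_N^{a+b}`. -/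
theorem base_rpow_mul_rpow (N : ℕ) (a b : ℝ) : base N ^ a * base N ^ b = base N ^ (a + b) :=
  (Real.rpow_add (base_pos N) a b).symm

/-- `(x_N^{a})^{n} = x_N^{n a}` for a natural exponent. -/
theorem base_rpow_pow (N : ℕ) (a : ℝ) (n : ℕ) : (base N ^ a) ^ n = base N ^ ((n : ℝ) * a) := by
  rw [← Real.rpow_natCast, ← Real.rpow_mul (base_pos N).le, mul_comm]

/-- `x_N · x_N^{a} = x_N^{a+1}`. -/
theorem base_mul_rpow (N : ℕ) (a : ℝ) : base N * base N ^ a = base N ^ (a + 1) := by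
  rw [Real.rpow_add_one (base_pos N).ne', mul_comm]

/-- Positive powers of `x_N` tend to infinity, negative powers to zero. -/
theorem tendsto_base_rpow_atTop {e : ℝ} (he : 0 < e) : Tendsto (fun N : ℕ => base N ^ e) atTop atTop :=
  TailsVmax.tendsto_natSucc_rpow_atTop he

/-- Negative powers of `x_N` tend to zero. -/
theorem tendsto_base_rpow_neg {e : ℝ} (he : 0 < e) : Tendsto (fun N : ℕ => base N ^ (-e)) atTop (𝓝 0) := by
  have h := (tendsto_base_rpow_atTop he).inv_tendsto_atTop
  refine h.congr fun N => ?_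
  rw [Pi.inv_apply, Real.rpow_neg (base_pos N).le]

/-- `ℓ_N (N+1)^{1/6} = (N+1)^{-1/12}/4 → 0` (the cell is SUB-BLOCK for every admissible block exponent). -/
theorem tendsto_cellRad_subBlock :
    Tendsto (fun N : ℕ => cellRad N * ((N + 1 : ℕ) : ℝ) ^ ((1 : ℝ) / 6)) atTop (𝓝 0) := by
  have h : ∀ N : ℕ, cellRad N * ((N + 1 : ℕ) : ℝ) ^ ((1 : ℝ) / 6) = 4⁻¹ * base N ^ (-(1 / 12 : ℝ)) := by
    intro N
    show 4⁻¹ * base N ^ (-(1 / 4 : ℝ)) * base N ^ ((1 : ℝ) / 6) = _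
    rw [mul_assoc, base_rpow_mul_rpow]; norm_num
  simp_rw [h]
  simpa using (tendsto_base_rpow_neg (show (0 : ℝ) < 1 / 12 by norm_num)).const_mul 4⁻¹

/-- `(N+1) ℓ_N³ = (N+1)^{1/4}/64 → ∞` (cells hold many particles). -/
theorem tendsto_cellRad_mass :
    Tendsto (fun N : ℕ => ((N + 1 : ℕ) : ℝ) * cellRad N ^ 3) atTop atTop := by
  have h : ∀ N : ℕ, ((N + 1 : ℕ) : ℝ) * cellRad N ^ 3 = 64⁻¹ * base N ^ ((1 : ℝ) / 4) := by
    intro N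
    show base N * (4⁻¹ * base N ^ (-(1 / 4 : ℝ))) ^ 3 = _
    rw [mul_pow, base_rpow_pow, mul_left_comm, base_mul_rpow]
    norm_num
  simp_rw [h]
  exact (tendsto_base_rpow_atTop (show (0 : ℝ) < 1 / 4 by norm_num)).const_mul_atTop (by norm_num)

/-- **The canonical cell kernel family is a `CellKernel`.** -/
theorem cellKernel_cellKer : CellKernel cellKer cellRad :=
  ⟨continuous_cellKer, cellKer_nonneg, integral_cellKer, cellRad_pos,
    fun N _ hy => cellKer_eq_zero_of_le N hy, ⟨16 / ballVol, cellKer_le⟩,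
    ⟨1 / (2 * ballVol), by have := ballVol_pos; positivity, fun N _ hy => le_cellKer N hy⟩,
    tendsto_cellRad_subBlock, tendsto_cellRad_mass⟩

/-- **The canonical window is a kinetic `Window`**: `Δ_N > 0`, `Δ_N → 0`, `Δ_N (N+1)^{1/3} = (N+1)^{7/24} → ∞`. -/
theorem window_kinWin : Window kinWin := by
  refine ⟨kinWin_pos, tendsto_base_rpow_neg (show (0 : ℝ) < 1 / 24 by norm_num), ?_⟩
  have h : ∀ N : ℕ, kinWin N * ((N + 1 : ℕ) : ℝ) ^ ((1 : ℝ) / 3) = base N ^ ((7 : ℝ) / 24) := by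
    intro N
    show base N ^ (-(1 / 24 : ℝ)) * base N ^ ((1 : ℝ) / 3) = _
    rw [base_rpow_mul_rpow]; norm_num
  simp_rw [h]
  exact tendsto_base_rpow_atTop (by norm_num)

/-- **First scale relation** (the window outlasts the cell viscous time, `K_N ≫ L_N²`):
`Δ_N/(ℓ_N²(N+1)^{1/3}) = 16 (N+1)^{1/8} → ∞`. -/
theorem tendsto_scale_viscous :
    Tendsto (fun N : ℕ => kinWin N / (cellRad N ^ 2 * ((N + 1 : ℕ) : ℝ) ^ ((1 : ℝ) / 3))) atTop atTop := by
  have h : ∀ N : ℕ, kinWin N / (cellRad N ^ 2 * ((N + 1 : ℕ) : ℝ) ^ ((1 : ℝ) / 3)) = 16 * base N ^ ((1 : ℝ) / 8) := by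
    intro N
    have hb := base_pos N
    show base N ^ (-(1 / 24 : ℝ)) / ((4⁻¹ * base N ^ (-(1 / 4 : ℝ))) ^ 2 * base N ^ ((1 : ℝ) / 3)) = _
    rw [mul_pow, base_rpow_pow, mul_assoc, base_rpow_mul_rpow]
    conv_lhs => rw [div_eq_mul_inv]; arg 2; rw [mul_inv, ← Real.rpow_neg hb.le]
    rw [mul_left_comm, base_rpow_mul_rpow]
    norm_num [mul_comm]
  simp_rw [h]
  exact (tendsto_base_rpow_atTop (by norm_num)).const_mul_atTop (by norm_num)

/-- **Second scale relation** (the window outlasts the cell decoupling scale, `K_N ≫ m_cell`):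
`Δ_N (N+1)^{1/3}/((N+1)ℓ_N³) = 64 (N+1)^{1/24} → ∞`. -/
theorem tendsto_scale_decoupling :
    Tendsto (fun N : ℕ => kinWin N * ((N + 1 : ℕ) : ℝ) ^ ((1 : ℝ) / 3) / (((N + 1 : ℕ) : ℝ) * cellRad N ^ 3))
      atTop atTop := by
  have h : ∀ N : ℕ, kinWin N * ((N + 1 : ℕ) : ℝ) ^ ((1 : ℝ) / 3) / (((N + 1 : ℕ) : ℝ) * cellRad N ^ 3) =
      64 * base N ^ ((1 : ℝ) / 24) := by
    intro N
    have hb := base_pos N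
    show base N ^ (-(1 / 24 : ℝ)) * base N ^ ((1 : ℝ) / 3) / (base N * (4⁻¹ * base N ^ (-(1 / 4 : ℝ))) ^ 3) = _
    rw [base_rpow_mul_rpow, mul_pow, base_rpow_pow, mul_left_comm (base N), base_mul_rpow, div_eq_mul_inv,
      mul_inv, ← Real.rpow_neg hb.le, mul_left_comm, base_rpow_mul_rpow]
    norm_num [mul_comm]
  simp_rw [h]
  exact (tendsto_base_rpow_atTop (by norm_num)).const_mul_atTop (by norm_num)

/-! ## The core of the stub and the reduction -/

/-- **THE CORE of `stub_superExp`** at reference temperature `θe`, reduced diameter `σ` and block kernel family `φ`: for the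
CANONICAL cell kernel and window, every flow family and every `a, λ, Cw > 0` there is `ε > 0` such that for every rate `c > 0`,
eventually in `N`, the homogeneous Gibbs law `G_N = localGibbsLaw σ 1 0 θe` gives the sustained-anisotropy event with the window
`[0, Δ_N]` probability `≤ e^{-c(N+1)}`. (A predicate: the hypothesis of `superExpStub_of_core`, proved for no `(θe, σ, φ)` here.) -/
def SuperExpCore (θe σ : ℝ) (φ : ℕ → T3 → ℝ) : Prop :=
  ∀ (Φ : Flows σ) (a lam Cw : ℝ), 0 < a → 0 < lam → 0 < Cw → ∃ ε : ℝ, 0 < ε ∧ ∀ c : ℝ, 0 < c →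
    ∀ᶠ N : ℕ in atTop,
      localGibbsLaw σ (fun _ => 1) (fun _ => 0) (fun _ => θe) N (Φ N)
          (susEvent σ N (Φ N) φ cellKer (kinWin N) a ε lam Cw (kinWin N)) ≤
        ENNReal.ofReal (Real.exp (-(c * ((N : ℝ) + 1))))

/-- **REDUCTION.** `SuperExpStub` (the registered statement of `stub_superExp`, with its `∃ σ₁` and `∃ (ψ, ℓ, Δ)`) follows from the
core bound for the canonical scales at the window start, granted for all small `σ` and all admissible block kernels, TOGETHER with
uniformity in the window end (hypothesis `hunif`, discharged by `SuperExp.gibbs_susEvent_le` of `…SASuperExpInvariance`). -/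
theorem superExpStub_of_core
    (hunif : ∀ (σ θe : ℝ) (N : ℕ) (Φ : Flow σ N) (φ ψ : ℕ → T3 → ℝ) (Δ a ε lam Cw t' : ℝ),
      localGibbsLaw σ (fun _ => 1) (fun _ => 0) (fun _ => θe) N Φ (susEvent σ N Φ φ ψ Δ a ε lam Cw t') ≤
        localGibbsLaw σ (fun _ => 1) (fun _ => 0) (fun _ => θe) N Φ (susEvent σ N Φ φ ψ Δ a ε lam Cw Δ))
    (hcore : ∀ θe : ℝ, 0 < θe → ∃ σ₁ : ℝ, 0 < σ₁ ∧ ∀ σ : ℝ, 0 < σ → σ < σ₁ →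
      ∀ (γ C : ℝ) (φ : ℕ → T3 → ℝ), 0 < γ → γ ≤ 1 / 15 → AdmissibleKernel γ C φ → SuperExpCore θe σ φ) :
    SuperExpStub := by
  intro θe hθe
  obtain ⟨σ₁, hσ₁, H⟩ := hcore θe hθe
  refine ⟨σ₁, hσ₁, fun σ hσ hσ' γ C φ hγ hγ' hadm => ?_⟩
  refine ⟨cellKer, cellRad, kinWin, cellKernel_cellKer, window_kinWin, tendsto_scale_viscous,
    tendsto_scale_decoupling, fun Φ a lam Cw ha hlam hCw => ?_⟩
  obtain ⟨ε, hε, Hc⟩ := H σ hσ hσ' γ C φ hγ hγ' hadm Φ a lam Cw ha hlam hCw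
  refine ⟨ε, hε, fun c hc => ?_⟩
  filter_upwards [Hc c hc] with N hN t' _
  exact (hunif σ θe N (Φ N) φ cellKer (kinWin N) a ε lam Cw t').trans hN

end SuperExp

/-- Registered anchor of this helper file: the canonical cell kernel family and kinetic window discharge the existential of
`stub_superExp` (`CellKernel`, `Window` and the two scale relations). -/
theorem superExp_scales_anchor : ∃ (ψ : ℕ → T3 → ℝ) (ℓ Δ : ℕ → ℝ), CellKernel ψ ℓ ∧ Window Δ ∧
    Tendsto (fun N : ℕ => Δ N / (ℓ N ^ 2 * ((N + 1 : ℕ) : ℝ) ^ ((1 : ℝ) / 3))) atTop atTop ∧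
    Tendsto (fun N : ℕ => Δ N * ((N + 1 : ℕ) : ℝ) ^ ((1 : ℝ) / 3) / (((N + 1 : ℕ) : ℝ) * ℓ N ^ 3)) atTop atTop :=
  ⟨SuperExp.cellKer, SuperExp.cellRad, SuperExp.kinWin, SuperExp.cellKernel_cellKer, SuperExp.window_kinWin,
    SuperExp.tendsto_scale_viscous, SuperExp.tendsto_scale_decoupling⟩

end

end Summit.AtomisticToContinuum.HydrodynamicLimit.Theorems.SustainedAnisotropy
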